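import Mathlib
import HarnessLib
import Literature.Analysis.FluidPDE.SuitableWeak
import Literature.Analysis.FluidPDE.SelfSimilar
import Literature.Analysis.FluidPDE.LocalTypeI
import Literature.Analysis.FluidPDE.LocalTypeIScaling
import Literature.Analysis.FluidPDE.LocalTypeIReverseZoom
import Summits.NavierStokesRegularity.NavierStokesRegularity.Theorems.RellichScarApexLocalisationApexOfDecaying

/-!
# No mild scar under Type I (route RellichScar, item `NoMildScar`): the blow-up family at the apex

Helper file for the proof of `Summit.NavierStokesRegularity.NavierStokesRegularity.Theses.RellichScar.NoMildScar`
(stmt-NavierStokesRegularity-11723).  The proof zooms IN at the space–time origin of an apex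
Type-I profile `u` (suitable weak solution of Navier–Stokes on the backward slab `(-∞, 0) × ℝ³`
with `𝐈 < ∞`, `‖u(t, x)‖ ≤ C/(‖x‖ + √(−t))`, backward-singular origin):
`u_c(s, y) = c u(c² s, c y)`, `c ↓ 0`.  This file records the covariance of all the data under
the zoom about the origin (the tree's `stPull`/`stAffine` calculus, `LocalTypeIScaling`,
`LocalTypeIReverseZoom`):

* `zoom_isSuitableWeakSolutionOn_slab`, `zoom_hasWeakSpatialGradientOn_slab` — the zoomed pair is a
  suitable weak solution on the slab with the zoomed weak gradient (the zoom maps the slab onto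
  itself);
* `zoom_hasTypeIDecay` — the apex bound is scale invariant (KNSS 2009, (1.6));
* `zoom_isBackwardSingularPoint` — so is the backward singularity of the origin
  (`‖u_c‖_{L^∞(Q(0,R))} = c ‖u‖_{L^∞(Q(0,cR))}`);
* `eLpNorm_top_zoom_sub` and `zoom_scar_tendsto` — the SCAR transports: if
  `esssup_{(−δ,0)×K} |u − σ| → 0` for every compact `K ∌ 0`, then the same holds for `u_c` with the
  zoomed scar `σ_c(y) = c σ(c y)` (`‖u_c − σ_c‖_{L^∞((−δ,0)×K)} = c ‖u − σ‖_{L^∞((−c²δ,0)×cK)}`).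

References: Albritton–Barker 2019 (arXiv:1811.00502), §3 (zooms of suitable weak solutions and
the scale invariance of `𝐈`); Koch–Nadirashvili–Seregin–Šverák 2009, (1.6).
-/

noncomputable section

-- the summit and its single sub-problem share the name (CONVENTIONS §1), as in every Theorems file
set_option linter.dupNamespace false

namespace Summit.NavierStokesRegularity.NavierStokesRegularity.Theorems.RellichScarNoMildScar

open MeasureTheory Set Function Metric Filter Topology TopologicalSpace
open scoped ENNReal NNReal Pointwise
open Literature.Analysis Literature.Analysis.FluidPDE
open Summit.NavierStokesRegularity.NavierStokesRegularity.Theorems.RellichScarApexLocalisation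

local notation "E³" => EuclideanSpace ℝ (Fin 3)

variable {u : ℝ → E³ → E³} {p : ℝ → E³ → ℝ} {G : ℝ → E³ → E³ →L[ℝ] E³} {c : ℝ}

/-! ### Covariance of the slab data under the zoom about the origin -/

/-- **The zoomed pair is a suitable weak solution on the slab** (the zoom about the space–time
origin maps the backward slab onto itself; covariance `zoom_isSuitableWeakSolutionOn`).
[cite: AlbrittonBarker2019, §3] -/
theorem zoom_isSuitableWeakSolutionOn_slab
    (hsw : IsSuitableWeakSolutionOn (slab E³ (Iio 0) isOpen_Iio) 1 0 u p) (hc : 0 < c) :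
    IsSuitableWeakSolutionOn (slab E³ (Iio 0) isOpen_Iio) 1 0
      (c • stPull (c ^ 2) c 0 (0 : E³) u) (c ^ 2 • stPull (c ^ 2) c 0 (0 : E³) p) := by
  have h := zoom_isSuitableWeakSolutionOn hsw hc 0 (0 : E³)
  rwa [stPreimage_slab_origin hc] at h

/-- **The zoomed weak gradient** on the slab (covariance `zoom_hasWeakSpatialGradientOn`).
[cite: AlbrittonBarker2019, §3] -/
theorem zoom_hasWeakSpatialGradientOn_slab
    (hwg : HasWeakSpatialGradientOn (slab E³ (Iio 0) isOpen_Iio) u G) (hc : 0 < c) :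
    HasWeakSpatialGradientOn (slab E³ (Iio 0) isOpen_Iio)
      (c • stPull (c ^ 2) c 0 (0 : E³) u) (c ^ 2 • stPull (c ^ 2) c 0 (0 : E³) G) := by
  have h := zoom_hasWeakSpatialGradientOn hwg hc 0 (0 : E³)
  rwa [stPreimage_slab_origin hc] at h

/-- The zoom about the origin in the `stPull` rendering is the tree's `nsRescale`. [folklore] -/
theorem zoom_eq_nsRescale (c : ℝ) (u : ℝ → E³ → E³) :
    c • stPull (c ^ 2) c 0 (0 : E³) u = nsRescale c u := by
  funext t x
  rw [smul_stPull_apply, nsRescale_apply, zero_add, zero_add]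

/-- **The apex bound is scale invariant**: `‖u_c(s, y)‖ ≤ C/(‖y‖ + √(−s))` (KNSS 2009, (1.6);
`HasTypeIDecay.nsRescale`). [cite: KNSS2009, (1.6)] -/
theorem zoom_hasTypeIDecay {C : ℝ} (hdec : HasTypeIDecay C u) (hc : 0 < c) :
    HasTypeIDecay C (c • stPull (c ^ 2) c 0 (0 : E³) u) := by
  rw [zoom_eq_nsRescale]
  exact hdec.nsRescale hc

/-- The zoom about the origin fixes the origin. [folklore] -/
theorem stAffine_origin_zero (c : ℝ) : stAffine (c ^ 2) c 0 (0 : E³) 0 = 0 := by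
  simp [stAffine, Prod.ext_iff]

/-- **Backward singularity of the origin is scale invariant**:
`‖u_c‖_{L^∞(Q(0,R))} = c ‖u‖_{L^∞(Q(0,cR))} = ∞`. [cite: AlbrittonBarker2019, §3] -/
theorem zoom_isBackwardSingularPoint (hs : IsBackwardSingularPoint u 0) (hc : 0 < c) :
    IsBackwardSingularPoint (c • stPull (c ^ 2) c 0 (0 : E³) u) 0 := by
  intro R hR
  rw [eLpNorm_top_nsZoom hc 0 (0 : E³) R 0 u, stAffine_origin_zero, hs (c * R) (mul_pos hc hR)]
  exact ENNReal.mul_top (ENNReal.ofReal_pos.2 hc).ne'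

/-! ### Transport of the scar -/

/-- **`L^∞` norms of the scar defect under the zoom**: for every set `S ⊆ ℝ × ℝ³`,
`‖u_c − σ_c‖_{L^∞(Φ_c⁻¹ S)} = c ‖u − σ‖_{L^∞(S)}`, where `Φ_c(s, y) = (c² s, c y)` and
`σ_c(y) = c σ(c y)` (change of variables; the essential supremum does not see the constant
Jacobian). [folklore] -/
theorem eLpNorm_top_zoom_sub (hc : 0 < c) (u : ℝ → E³ → E³) (σ : E³ → E³) (S : Set (ℝ × E³)) :
    eLpNorm (fun z : ℝ × E³ => (c • stPull (c ^ 2) c 0 (0 : E³) u) z.1 z.2 - c • σ (c • z.2)) ∞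
        (volume.restrict (stAffine (c ^ 2) c 0 (0 : E³) ⁻¹' S)) =
      ENNReal.ofReal c *
        eLpNorm (fun z : ℝ × E³ => u z.1 z.2 - σ z.2) ∞ (volume.restrict S) := by
  have hc2 : 0 < c ^ 2 := by positivity
  have hme := measurableEmbedding_stAffine (E := E³) hc2.ne' hc.ne' 0 (0 : E³)
  rw [eLpNorm_exponent_top, eLpNorm_exponent_top, eLpNormEssSup_eq_essSup_enorm,
    eLpNormEssSup_eq_essSup_enorm]
  have hF : (fun z : ℝ × E³ => ‖(c • stPull (c ^ 2) c 0 (0 : E³) u) z.1 z.2 - c • σ (c • z.2)‖ₑ) =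
      fun z => ENNReal.ofReal c *
        ((fun w : ℝ × E³ => ‖u w.1 w.2 - σ w.2‖ₑ) ∘ stAffine (c ^ 2) c 0 (0 : E³)) z := by
    funext ⟨s, y⟩
    simp only [smul_stPull_apply, Function.comp_apply, stAffine_apply, zero_add, ← smul_sub,
      enorm_smul, Real.enorm_eq_ofReal hc.le]
  rw [hF, ENNReal.essSup_const_mul]
  congr 1
  have h2 := hme.essSup_map_measure (μ := volume.restrict (stAffine (c ^ 2) c 0 (0 : E³) ⁻¹' S))
    (g := fun w : ℝ × E³ => ‖u w.1 w.2 - σ w.2‖ₑ)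
  rw [map_stAffine_volume_restrict_preimage hc2 hc, finrank_euclideanSpace_fin,
    essSup_ennreal_smul_measure (by simp; positivity)] at h2
  exact h2.symm

/-- The zoom pulls the box `(−c²δ, 0) × cK` back to `(−δ, 0) × K`. [folklore] -/
theorem stAffine_preimage_Ioo_prod_smul (hc : 0 < c) (δ : ℝ) (K : Set E³) :
    stAffine (c ^ 2) c 0 (0 : E³) ⁻¹' (Ioo (-(c ^ 2 * δ)) 0 ×ˢ (c • K)) = Ioo (-δ) 0 ×ˢ K := by
  have hc2 : 0 < c ^ 2 := by positivity
  ext ⟨s, y⟩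
  simp only [mem_preimage, stAffine_apply, zero_add, mem_prod, mem_Ioo]
  rw [Set.smul_mem_smul_set_iff₀ hc.ne']
  constructor
  · rintro ⟨⟨h1, h2⟩, h3⟩
    refine ⟨⟨by nlinarith, by nlinarith⟩, h3⟩
  · rintro ⟨⟨h1, h2⟩, h3⟩
    refine ⟨⟨by nlinarith, by nlinarith⟩, h3⟩

/-- A compact set missing the origin zooms to a compact set missing the origin. [folklore] -/
theorem isCompact_smul_and_zero_notMem (hc : 0 < c) {K : Set E³} (hK : IsCompact K)
    (h0 : (0 : E³) ∉ K) : IsCompact (c • K) ∧ (0 : E³) ∉ c • K := by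
  refine ⟨hK.smul c, fun h => h0 ?_⟩
  obtain ⟨k, hk, hk0⟩ := Set.mem_smul_set.1 h
  rcases smul_eq_zero.1 hk0 with h1 | h1
  · exact absurd h1 hc.ne'
  · rwa [h1] at hk

/-- **The scar transports under the zoom.**  If `esssup_{(−δ,0)×K} |u − σ| → 0` as `δ ↓ 0` for
every compact `K ∌ 0`, then for every `c > 0` the zoomed field `u_c` has the zoomed scar
`σ_c(y) = c σ(c y)` in the same sense. [folklore] -/
theorem zoom_scar_tendsto (hc : 0 < c) {σ : E³ → E³}
    (hscar : ∀ K : Set E³, IsCompact K → (0 : E³) ∉ K →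
      Tendsto (fun δ : ℝ => eLpNorm (fun z : ℝ × E³ => u z.1 z.2 - σ z.2) ⊤
        (volume.restrict (Ioo (-δ) 0 ×ˢ K))) (𝓝[>] 0) (𝓝 0))
    {K : Set E³} (hK : IsCompact K) (h0 : (0 : E³) ∉ K) :
    Tendsto (fun δ : ℝ => eLpNorm
        (fun z : ℝ × E³ => (c • stPull (c ^ 2) c 0 (0 : E³) u) z.1 z.2 - c • σ (c • z.2)) ⊤
        (volume.restrict (Ioo (-δ) 0 ×ˢ K))) (𝓝[>] 0) (𝓝 0) := by
  have hc2 : 0 < c ^ 2 := by positivity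
  obtain ⟨hcK, h0c⟩ := isCompact_smul_and_zero_notMem hc hK h0
  -- `δ ↦ c² δ` preserves `𝓝[>] 0`
  have hmap : Tendsto (fun δ : ℝ => c ^ 2 * δ) (𝓝[>] 0) (𝓝[>] 0) := by
    refine tendsto_nhdsWithin_of_tendsto_nhds_of_eventually_within _ ?_ ?_
    · have : Tendsto (fun δ : ℝ => c ^ 2 * δ) (𝓝 0) (𝓝 (c ^ 2 * 0)) :=
        (continuous_const.mul continuous_id).tendsto 0
      rw [mul_zero] at this
      exact this.mono_left nhdsWithin_le_nhds
    · filter_upwards [self_mem_nhdsWithin] with δ hδ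
      exact mul_pos hc2 hδ
  have h1 := (hscar (c • K) hcK h0c).comp hmap
  have h2 := ENNReal.Tendsto.const_mul h1 (Or.inr ENNReal.ofReal_ne_top) (a := ENNReal.ofReal c)
  rw [mul_zero] at h2
  refine (tendsto_congr fun δ => ?_).1 h2
  rw [Function.comp_apply, ← eLpNorm_top_zoom_sub hc u σ, stAffine_preimage_Ioo_prod_smul hc]

/-! ### The zoomed scar in `L³` -/

/-- **The zoomed scar is the zoom of the scar as an `L³` function**: for `0 < c` and a ball
`B(0, ρ)` with `c ρ ≤ r`, `∫_{B(0,ρ)} ‖σ_c‖³ = ∫_{B(0,cρ)} ‖σ‖³` (`L³` is scale critical), so the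
zoomed scars tend to zero in `L³_loc` as `c ↓ 0` whenever `σ ∈ L³(B(0, r))`.  This lemma records
the change of variables `∫_{B(0,ρ)} F(c y) dy = c⁻³ ∫_{B(0,cρ)} F`. [folklore] -/
theorem lintegral_ball_comp_smul (hc : 0 < c) (F : E³ → ℝ≥0∞) (ρ : ℝ) :
    ∫⁻ y in ball (0 : E³) ρ, F (c • y) =
      ENNReal.ofReal (c ^ 3)⁻¹ * ∫⁻ x in ball (0 : E³) (c * ρ), F x := by
  have h := setLIntegral_preimage_comp_space_affine (E := E³) hc (0 : E³) F (ball (0 : E³) (c * ρ))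
  rw [finrank_euclideanSpace_fin] at h
  have hpre : (fun y : E³ => (0 : E³) + c • y) ⁻¹' ball (0 : E³) (c * ρ) = ball (0 : E³) ρ := by
    have := space_affine_preimage_ball_zoom hc (0 : E³) (0 : E³) ρ
    simpa using this
  rw [hpre] at h
  simpa using h

end Summit.NavierStokesRegularity.NavierStokesRegularity.Theorems.RellichScarNoMildScar

end
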